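import Summits.NavierStokesRegularity.NavierStokesRegularity.Theorems.QuantisedSymmetryPolyhedralDssProfileExistsStubSchurJet
import Mathlib.MeasureTheory.Integral.Bochner.ContinuousLinearMap
import Mathlib.MeasureTheory.Measure.Haar.InnerProductSpace
import Mathlib.MeasureTheory.Function.L2Space
import Mathlib.Analysis.InnerProductSpace.PiL2
import HarnessLib

/-!
# Crux `PolyhedralDssProfileExists` (stmt-NavierStokesRegularity-1404), line `polyhedral_cell` —
# stub `stub_isotropicMoments` (Schur on `Sym² ℝ³`: isotropy of the weighted second moments)

Let `G` be a group of linear isometries of `ℝ³ = EuclideanSpace ℝ (Fin 3)` acting irreducibly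
(every `G`-invariant subspace is `⊥` or `⊤`), let `w : ℝ³ → ℝ³` be continuous and `G`-equivariant,
`w (g x) = g (w x)`, and let `φ : ℝ → ℝ` be a continuous radial weight with
`x ↦ φ ‖x‖ * ‖w x‖ ^ 2` integrable. Then every radially weighted second-moment tensor
`S a b = ∫ φ ‖x‖ ⟪a, w x⟫ ⟪b, w x⟫ dx` is isotropic:
`S a b = ⟪a, b⟫ / 3 * ∫ φ ‖x‖ ‖w x‖ ^ 2 dx`.

Proof: the operator `T b = ∫ (φ ‖x‖ ⟪b, w x⟫) • w x dx` (a Bochner integral, integrable by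
Cauchy–Schwarz) is linear, symmetric (`⟪a, T b⟫ = S a b = S b a`) and commutes with `G` (change of
variables `x = g y`, `g` is measure preserving, `‖g y‖ = ‖y‖`, `⟪g b, g (w y)⟫ = ⟪b, w y⟫`, and `g`
commutes with the Bochner integral); by the real Schur lemma
(`schurJet_isSymmetric_eq_smul`, Serre, *Linear Representations of Finite Groups*, §13.2;
bib `SerreLinearRepresentations1977`) `T = μ • id`, and the trace over an orthonormal basis gives
`3 μ = ∑ i, S (e i) (e i) = ∫ φ ‖x‖ ‖w x‖ ^ 2`. All ingredients are Mathlib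
(`LinearIsometryEquiv.measurePreserving`, `MeasurePreserving.integral_comp`,
`ContinuousLinearEquiv.integral_comp_comm`, `integral_inner`, `OrthonormalBasis.sum_sq_inner_right`).
-/

noncomputable section

open MeasureTheory Set Function Filter Topology
open Literature.Analysis.FluidPDE
open scoped InnerProductSpace RealInnerProductSpace

-- the summit namespace …NavierStokesRegularity.NavierStokesRegularity… is the tree convention (D-0017)
set_option linter.dupNamespace false

namespace Summit.NavierStokesRegularity.NavierStokesRegularity.Theorems.PolyhedralDssProfileExists.PolyhedralCell

variable {w : EuclideanSpace ℝ (Fin 3) → EuclideanSpace ℝ (Fin 3)} {φ : ℝ → ℝ}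

/-- **The vector moment integrand is integrable**: for continuous `w`, `φ` with
`x ↦ φ ‖x‖ * ‖w x‖ ^ 2` integrable, `x ↦ (φ ‖x‖ * ⟪b, w x⟫) • w x` is integrable — it is continuous
and dominated by `‖b‖ * |φ ‖x‖| * ‖w x‖ ^ 2` (Cauchy–Schwarz). [folklore] -/
theorem isoMoments_integrable_smul (hw : Continuous w) (hφ : Continuous φ)
    (hint : Integrable (fun x => φ ‖x‖ * ‖w x‖ ^ 2) volume) (b : EuclideanSpace ℝ (Fin 3)) :
    Integrable (fun x => (φ ‖x‖ * ⟪b, w x⟫_ℝ) • w x) volume := by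
  refine Integrable.mono' (hint.norm.const_mul ‖b‖) ?_ (Eventually.of_forall fun x => ?_)
  · exact (((hφ.comp continuous_norm).mul (continuous_const.inner hw)).smul hw).aestronglyMeasurable
  · rw [norm_smul, norm_mul, Real.norm_eq_abs, Real.norm_eq_abs, Real.norm_eq_abs, abs_mul,
      abs_of_nonneg (by positivity : (0 : ℝ) ≤ ‖w x‖ ^ 2)]
    calc |φ ‖x‖| * |⟪b, w x⟫_ℝ| * ‖w x‖ ≤ |φ ‖x‖| * (‖b‖ * ‖w x‖) * ‖w x‖ := by
          gcongr
          exact abs_real_inner_le_norm _ _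
      _ = ‖b‖ * (|φ ‖x‖| * ‖w x‖ ^ 2) := by ring

/-- **The scalar moment integrand is integrable**: `x ↦ φ ‖x‖ * (⟪a, w x⟫ * ⟪b, w x⟫)` is the inner
product of the constant `a` with the integrable vector integrand. [folklore] -/
theorem isoMoments_integrable_mul (hw : Continuous w) (hφ : Continuous φ)
    (hint : Integrable (fun x => φ ‖x‖ * ‖w x‖ ^ 2) volume) (a b : EuclideanSpace ℝ (Fin 3)) :
    Integrable (fun x => φ ‖x‖ * (⟪a, w x⟫_ℝ * ⟪b, w x⟫_ℝ)) volume := by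
  refine (Integrable.const_inner (𝕜 := ℝ) a (isoMoments_integrable_smul hw hφ hint b)).congr
    (Eventually.of_forall fun x => ?_)
  simp only [real_inner_smul_right]
  ring

/-- **The moment operator represents the moment form**:
`⟪a, ∫ (φ ‖x‖ * ⟪b, w x⟫) • w x⟫ = ∫ φ ‖x‖ * (⟪a, w x⟫ * ⟪b, w x⟫)` (the inner product with a
constant commutes with the Bochner integral). [folklore] -/
theorem isoMoments_inner_integral (hw : Continuous w) (hφ : Continuous φ)
    (hint : Integrable (fun x => φ ‖x‖ * ‖w x‖ ^ 2) volume) (a b : EuclideanSpace ℝ (Fin 3)) :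
    ⟪a, ∫ x, (φ ‖x‖ * ⟪b, w x⟫_ℝ) • w x⟫_ℝ = ∫ x, φ ‖x‖ * (⟪a, w x⟫_ℝ * ⟪b, w x⟫_ℝ) := by
  rw [← integral_inner (𝕜 := ℝ) (isoMoments_integrable_smul hw hφ hint b) a]
  refine integral_congr_ae (Eventually.of_forall fun x => ?_)
  simp only [real_inner_smul_right]
  ring

/-- **The moment operator is an intertwiner**: if `w (g x) = g (w x)` for a linear isometry `g` of
`ℝ³`, then `∫ (φ ‖x‖ * ⟪g v, w x⟫) • w x = g (∫ (φ ‖x‖ * ⟪v, w x⟫) • w x)` — change variables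
`x = g y` (`g` preserves Lebesgue measure), use `‖g y‖ = ‖y‖`, `⟪g v, g (w y)⟫ = ⟪v, w y⟫`, and pull
the isometry `g` out of the Bochner integral. [folklore] -/
theorem isoMoments_integral_map
    (g : EuclideanSpace ℝ (Fin 3) ≃ₗᵢ[ℝ] EuclideanSpace ℝ (Fin 3)) (hwg : ∀ x, w (g x) = g (w x))
    (v : EuclideanSpace ℝ (Fin 3)) :
    ∫ x, (φ ‖x‖ * ⟪g v, w x⟫_ℝ) • w x = g (∫ x, (φ ‖x‖ * ⟪v, w x⟫_ℝ) • w x) := by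
  have h1 : ∫ y, (φ ‖g y‖ * ⟪g v, w (g y)⟫_ℝ) • w (g y) = ∫ x, (φ ‖x‖ * ⟪g v, w x⟫_ℝ) • w x :=
    g.measurePreserving.integral_comp g.toHomeomorph.measurableEmbedding
      (fun x => (φ ‖x‖ * ⟪g v, w x⟫_ℝ) • w x)
  rw [← h1]
  simp_rw [hwg, LinearIsometryEquiv.norm_map, LinearIsometryEquiv.inner_map_map,
    ← LinearIsometryEquiv.map_smul]
  rw [← LinearIsometryEquiv.coe_toContinuousLinearEquiv, ContinuousLinearEquiv.integral_comp_comm]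

/-- **The moment form is a linear operator**: there is a linear map `T` of `ℝ³` with
`T b = ∫ (φ ‖x‖ * ⟪b, w x⟫) • w x` (additivity and homogeneity of the Bochner integral on integrable
integrands). [folklore] -/
theorem isoMoments_exists_linearMap (hw : Continuous w) (hφ : Continuous φ)
    (hint : Integrable (fun x => φ ‖x‖ * ‖w x‖ ^ 2) volume) :
    ∃ T : EuclideanSpace ℝ (Fin 3) →ₗ[ℝ] EuclideanSpace ℝ (Fin 3),
      ∀ b, T b = ∫ x, (φ ‖x‖ * ⟪b, w x⟫_ℝ) • w x := by
  refine ⟨{ toFun := fun b => ∫ x, (φ ‖x‖ * ⟪b, w x⟫_ℝ) • w x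
            map_add' := fun b c => ?_
            map_smul' := fun c b => ?_ }, fun b => rfl⟩
  · simp only [inner_add_left, mul_add, add_smul]
    exact integral_add (isoMoments_integrable_smul hw hφ hint b)
      (isoMoments_integrable_smul hw hφ hint c)
  · simp only [real_inner_smul_left, RingHom.id_apply, ← integral_smul, smul_smul]
    exact integral_congr_ae (Eventually.of_forall fun x => by simp only [mul_left_comm (φ ‖x‖) c])

/-- **The trace of the moment form**: summing the diagonal moments over the standard orthonormal
basis of `ℝ³` gives `∫ φ ‖x‖ * ‖w x‖ ^ 2` (Parseval `∑ i, ⟪e i, u⟫ ^ 2 = ‖u‖ ^ 2` under the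
integral sign). [folklore] -/
theorem isoMoments_sum_diag (hw : Continuous w) (hφ : Continuous φ)
    (hint : Integrable (fun x => φ ‖x‖ * ‖w x‖ ^ 2) volume) :
    ∑ i, ∫ x, φ ‖x‖ * (⟪EuclideanSpace.basisFun (Fin 3) ℝ i, w x⟫_ℝ *
        ⟪EuclideanSpace.basisFun (Fin 3) ℝ i, w x⟫_ℝ) = ∫ x, φ ‖x‖ * ‖w x‖ ^ 2 := by
  rw [← integral_finsetSum _ fun i _ => isoMoments_integrable_mul hw hφ hint _ _]
  refine integral_congr_ae (Eventually.of_forall fun x => ?_)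
  simp only
  rw [← Finset.mul_sum, ← (EuclideanSpace.basisFun (Fin 3) ℝ).sum_sq_inner_right (w x)]
  simp only [sq]

/-- **Stub N6: isotropy of the weighted second moments (Schur on `Sym² ℝ³`).** If `G` acts
irreducibly on `ℝ³` (every `G`-invariant subspace is `⊥` or `⊤`), `w : ℝ³ → ℝ³` is continuous and
`G`-equivariant, and `φ` is a continuous radial weight with `φ ‖x‖ * ‖w x‖ ^ 2` integrable, then
`∫ φ ‖x‖ ⟪a, w x⟫ ⟪b, w x⟫ = ⟪a, b⟫ / 3 * ∫ φ ‖x‖ ‖w x‖ ^ 2` for all `a b`: the moment operator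
`T b = ∫ (φ ‖x‖ ⟪b, w x⟫) • w x` is a symmetric `G`-intertwiner, hence a scalar `μ` by the real
Schur lemma, and its trace `3 μ = ∫ φ ‖w‖ ^ 2` identifies `μ`. Shell by shell, the Reynolds stress
of any polyhedrally symmetric profile is isotropic.
[cite: SerreLinearRepresentations1977, §13.2 (real Schur lemma)] -/
theorem stub_isotropicMoments :
    ∀ (G : Subgroup (EuclideanSpace ℝ (Fin 3) ≃ₗᵢ[ℝ] EuclideanSpace ℝ (Fin 3))),
      (∀ V : Submodule ℝ (EuclideanSpace ℝ (Fin 3)), (∀ g ∈ G, ∀ v ∈ V, g v ∈ V) → V = ⊥ ∨ V = ⊤) →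
      ∀ (w : EuclideanSpace ℝ (Fin 3) → EuclideanSpace ℝ (Fin 3)) (φ : ℝ → ℝ),
        Continuous w → Continuous φ → (∀ g ∈ G, ∀ x, w (g x) = g (w x)) →
        Integrable (fun x => φ ‖x‖ * ‖w x‖ ^ 2) volume →
        ∀ a b : EuclideanSpace ℝ (Fin 3),
          ∫ x, φ ‖x‖ * (⟪a, w x⟫_ℝ * ⟪b, w x⟫_ℝ) = ⟪a, b⟫_ℝ / 3 * ∫ x, φ ‖x‖ * ‖w x‖ ^ 2 := by
  intro G hirr w φ hw hφ hequiv hint a b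
  obtain ⟨T, hT⟩ := isoMoments_exists_linearMap hw hφ hint
  -- `T` represents the moment form
  have hkey : ∀ a b, ⟪a, T b⟫_ℝ = ∫ x, φ ‖x‖ * (⟪a, w x⟫_ℝ * ⟪b, w x⟫_ℝ) := fun a b => by
    rw [hT]
    exact isoMoments_inner_integral hw hφ hint a b
  -- `T` is symmetric
  have hsymm : T.IsSymmetric := by
    intro u v
    rw [real_inner_comm v (T u), hkey, hkey]
    refine integral_congr_ae (Eventually.of_forall fun x => ?_)
    simp only
    ring
  -- `T` commutes with `G`
  have hcomm : ∀ g ∈ G, ∀ v, T (g v) = g (T v) := fun g hg v => by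
    rw [hT, hT]
    exact isoMoments_integral_map g (hequiv g hg) v
  -- Schur: `T` is a scalar
  obtain ⟨μ, hμ⟩ := schurJet_isSymmetric_eq_smul hirr hsymm hcomm
  -- the trace identifies the scalar
  have h3 : 3 * μ = ∫ x, φ ‖x‖ * ‖w x‖ ^ 2 := by
    rw [← isoMoments_sum_diag hw hφ hint]
    simp_rw [← hkey, hμ, real_inner_smul_right, (EuclideanSpace.basisFun (Fin 3) ℝ).inner_eq_one]
    simp only [mul_one, Finset.sum_const, Finset.card_univ, Fintype.card_fin, nsmul_eq_mul,
      Nat.cast_ofNat]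
  rw [← hkey, hμ, real_inner_smul_right, ← h3]
  ring

end Summit.NavierStokesRegularity.NavierStokesRegularity.Theorems.PolyhedralDssProfileExists.PolyhedralCell
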